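import Summits.BirchSwinnertonDyer.Rank1Residual.X9.TransportSweepA
import Literature.NumberTheory.EllipticCurves.Fisher2012.HesseFamilyFiveCongruence
import HarnessLib

/-!
# Class X9, `p = 5`: Greenberg–Vatsal transport from a `5`-congruent partner OUTSIDE the tables — the partner is a member
# of Fisher's Hesse pencil `X_E(5)` (or of the indirect family `X_E⁻(5)`), so the congruence C1 is a THEOREM, not a trace list

HONEST FRAMING (cell `b2b-bsdres-*`, verbatim): the cell deletes COMBINATION-SHAPED residual classes of
the rank-≤1 BSD formula from PUBLISHED theorems only and TYPES the construction-shaped remainder; this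
is not "finishing BSD". Class X9 (good ordinary `p ≥ 5`, `ρ̄_{E,p}` irreducible and not surjective) stays
TYPED at class level; everything here is PER PAIR; no lane verdict is changed; no named fact is introduced
(the two Fisher facts are ALREADY in the tree, `Literature/…/Fisher2012/HesseFamilyFiveCongruence.lean`);
nothing is booked by this unit (the lane books, the referee rules). Unit `b2b-bsdres-x9`, gen 17.

## What this file does (our own work, hence `Summits/`)

After gen 16 exactly 40 X9 pairs `(E, 5)` with `N < 5·10⁵`, `r_an ≤ 1` had no flag-free route: one multiplicative
prime `ℓ` with `5 ∣ c_ℓ` inflates every Heegner index, and NO congruent partner with a flag-free certificate exists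
below `5·10⁵` (gen 16's screen of all `2 164 260` Cremona classes). But `X_E(5) ≅ ℙ¹`: EVERY elliptic curve has
infinitely many `5`-congruent partners, given by Fisher's explicit Hesse pencil (Proc. LMS 104 (2012) Thm. 13.2,
formulae of Rubin–Silverberg; tree fact `Fisher2012.thm132_fiveCongruent_hessePencil`) and by the indirect family
`X_E⁻(5)` (Math. Ann. 356 (2013) Thm. 5.8; tree fact `Fisher2012.thm58_fiveCongruent_hessePencilInd`). Gen 17 SEARCHED
these families beyond the tables (kit j134197–j134206, j134278–j134287; `HOME/b2b-bsdres-x9/X9-CENSUS-G17.md`) for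
members `F` with `5 ∤ N_F`, good ordinary at `5`, every Tamagawa number prime to `5`, analytic rank `≤ 1`, and a
Heegner index certificate of `5`-adic order `0` computable by the cell's engines — and found them for several targets
(conductors `6·10⁵ … 3·10⁷`). This file is the GENERIC consumer for such a partner; it is the Hesse-pencil twin of
`bsdp_of_ainvs_of_bsdpPartner_of_congruences_of_analyticRank_le_one` (`X9/TransportSweepA.lean`, gen 16), whose C1
binder (the Kraus–Oesterlé trace list up to the Sturm-type bound, two engines) is impossible at these conductors and
is REPLACED by the published theorem: a rational point `(l : m)` of `X_E(5)` and the identity "the partner `A` is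
`ℚ`-isomorphic to the pencil member `E_{l,m}`" — an identity of five rational numbers, `C • A = E_{l,m}` for an
explicit change of variables `C` (`hC`, decided by `norm_num` in each record once the two Hesse covariants are
EVALUATED at `(l, m)`; the evaluations `𝔠₄(l,m) = r₄`, `𝔠₆(l,m) = r₆` enter as the displayed binders `h4`, `h6` of
the records — exact rational identities certified by two independent exact engines (PARI `subst`; pure-Python
`hesse_exact.py`), and dischargeable in the kernel by closed-form evaluation lemmas for the degree-`20`/`30`
covariants when those land (cc-eng-2, announced INBOX 2026-08-21T14:46Z)).

* `torsionIso_of_hessePencil5` / `torsionIso_of_hessePencil5ind` — `A[5] ≅ E[5]` `Γ_ℚ`-equivariantly from `hF` and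
  `hC : C • A = E_{l,m}` (composition of Fisher's theorem, transported to the model `E` by
  `Fisher2012.fiveCongruent_hessePencil5{,ind}`, with the change-of-variables isomorphism `A[5] ≅ (C • A)[5]`).
* `hessePencil5_eq_of_eval` / `hessePencil5ind_eq_of_eval` — the pencil member from the two evaluations.
* `bsdp_of_ainvs_of_bsdpPartner_of_hessePencil5_of_analyticRank_le_one` (and `…hessePencil5ind…`) — `BSD(E,5)` for a
  target of analytic rank `≤ 1` from such a partner of analytic rank `≤ 1`: every Galois/reduction hypothesis of BOTH
  curves from decidable integer data (as in gen 16's consumer: `5 ∤ Δ`, kernel point counts, a Frobenius witness for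
  the irreducibility of `E[5]` — `A[5]` is then irreducible along the isomorphism); PUBLISHED binders `hF`, `hBCS`,
  `hGr`, `h5`, `hGV`, `hS`, `hPR`, `hmodP`, `hmodL`, `hGZK`; FINITE certificate binders `r_an(E) ≤ 1`, `r_an(A) ≤ 1`,
  `BSDp A 5` (the partner's `5`-part — in the records a KERNEL theorem from Cha's bound with a Heegner-index
  certificate, no booking currency needed), C2 `hcertA`, C3 `hSchA` / `hC3` (vacuous unless the respective analytic
  rank is `1`), and `hC`. Proof: `bsdp_of_bsdpPartner_of_partnerRank_le_one_of_irr` (gen 15) with C1 supplied by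
  the first bullet.

References: T. Fisher, Proc. LMS (3) 104 (2012) 613–648, Thm. 13.2 [Fisher2012Hessian]; T. Fisher, Math. Ann. 356
(2013) 589–616, Thm. 5.8 [Fisher2013QuinticTwists]; K. Rubin, A. Silverberg, Families of elliptic curves with constant
mod `p` representations (1995) [RubinSilverberg1995]; R. Greenberg, V. Vatsal, Invent. Math. 142 (2000) Thm. (1.4)
[GreenbergVatsal2000]; A. Burungale, F. Castella, C. Skinner, IMRN 2025 Thm. 1.1.2 (a) [BurungaleCastellaSkinner2025];
R. Greenberg, LNM 1716 (1999) Thm. 4.1 [GreenbergLNM1716]; B. Perrin-Riou, Invent. Math. 89 (1987) §1.4 [PerrinRiou1987];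
B. Mazur, IHÉS 47 (1978) Prop. 6.3 (1) [Mazur1978]; J. H. Silverman, AEC III §1, VII.1 [SilvermanAEC2009].
-/

set_option autoImplicit false

noncomputable section

open scoped Classical MatrixGroups ModularForm

open CongruenceSubgroup WeierstrassCurve Literature.NumberTheory.EllipticCurves
  Literature.NumberTheory.EllipticCurves.ModularForms Literature.NumberTheory.EllipticCurves.Rank1Residual
  Literature.NumberTheory.EllipticCurves.Rank1Residual.Typed
  Literature.NumberTheory.EllipticCurves.Rank1Residual.X11RankOneCertificates
  Literature.NumberTheory.EllipticCurves.Fisher2012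
  Summit.BirchSwinnertonDyer.BirchSwinnertonDyer.Rank1Residual.IntModel
  Summit.BirchSwinnertonDyer.BirchSwinnertonDyer.Rank1Residual.X11RankOne
  Summit.BirchSwinnertonDyer.Rank1Residual.X11b

namespace Summit.BirchSwinnertonDyer.Rank1Residual.X9

/-! ### §1. `A[5] ≅ E[5]` from a rational point of `X_E(5)` / `X_E⁻(5)` -/

/-- The Hesse-pencil member `E_{l,m}` written out from the two EVALUATED covariants `𝔠₄(l,m) = r₄`, `𝔠₆(l,m) = r₆`
(definitional unfolding of `Fisher2012.hessePencil5`). [cite: Fisher2012Hessian, Thm. 13.2 (the family E_{λ,μ})] -/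
theorem hessePencil5_eq_of_eval (c₄ c₆ l m r₄ r₆ : ℚ)
    (h4 : MvPolynomial.eval ![l, m] (hesseC4 c₄ c₆) = r₄)
    (h6 : MvPolynomial.eval ![l, m] (hesseC6 c₄ c₆) = r₆) :
    hessePencil5 c₄ c₆ l m = ⟨0, 0, 0, -27 * r₄, -54 * r₆⟩ := by
  simp only [hessePencil5, h4, h6]

/-- The indirect-family member `E_{l,m}` written out from the two EVALUATED covariants of Fisher 2013 Lemma 5.6
(definitional unfolding of `Fisher2012.hessePencil5ind`). [cite: Fisher2013QuinticTwists, Thm. 5.8 (the family E_{λ,μ})] -/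
theorem hessePencil5ind_eq_of_eval (c₄ c₆ l m r₄ r₆ : ℚ)
    (h4 : MvPolynomial.eval ![l, m] (hesseC4ind c₄ c₆) = r₄)
    (h6 : MvPolynomial.eval ![l, m] (hesseC6ind c₄ c₆) = r₆) :
    hessePencil5ind c₄ c₆ l m = ⟨0, 0, 0, -12 * r₄, -16 * r₆⟩ := by
  simp only [hessePencil5ind, h4, h6]

/-- **C1 as a theorem (direct family).** If the curve `A` is `ℚ`-isomorphic to the member `E_{l,m}` of the Hesse pencil
of `W` (`hC : C • A = E_{l,m}` for an explicit change of variables `C`), then `A[5] ≅ W[5]` as `Γ_ℚ`-modules — Fisher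
2012 Thm. 13.2 (`hF`, named fact of the tree) transported along `W ≅ c₄,c₆-model` (`fiveCongruent_hessePencil5`, proved
there) and along `A ≅ C • A` (`exists_geomTorsion_addEquiv_smul`, proved). [cite: Fisher2012Hessian, Thm. 13.2]
[cite: SilvermanAEC2009, III §1] -/
theorem torsionIso_of_hessePencil5 (hF : thm132_fiveCongruent_hessePencil)
    (W A : WeierstrassCurve ℚ) [W.IsElliptic] [A.IsElliptic] (l m : ℚ) (C : VariableChange ℚ)
    (hC : C • A = hessePencil5 W.c₄ W.c₆ l m) :
    ∃ e : geomTorsion A (5 : ℤ) ≃+ geomTorsion W (5 : ℤ),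
      ∀ (σ : Field.absoluteGaloisGroup ℚ) (P : geomTorsion A (5 : ℤ)), e (σ • P) = σ • e P := by
  haveI : (hessePencil5 W.c₄ W.c₆ l m).IsElliptic := by rw [← hC]; infer_instance
  obtain ⟨e₁, he₁⟩ := fiveCongruent_hessePencil5 hF W l m
  obtain ⟨e₂, he₂⟩ : ∃ e : geomTorsion A (5 : ℤ) ≃+ geomTorsion (hessePencil5 W.c₄ W.c₆ l m) (5 : ℤ),
      ∀ (σ : Field.absoluteGaloisGroup ℚ) (P : geomTorsion A (5 : ℤ)), e (σ • P) = σ • e P := by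
    rw [← hC]
    exact A.exists_geomTorsion_addEquiv_smul C 5
  exact ⟨e₂.trans e₁, fun σ P ↦ by rw [AddEquiv.trans_apply, AddEquiv.trans_apply, he₂, he₁]⟩

/-- **C1 as a theorem (indirect family).** The same with Fisher 2013 Thm. 5.8 (`hF'`, named fact of the tree) for a
curve `A` that is `ℚ`-isomorphic to a member of `X_W⁻(5)`. [cite: Fisher2013QuinticTwists, Thm. 5.8]
[cite: SilvermanAEC2009, III §1] -/
theorem torsionIso_of_hessePencil5ind (hF' : thm58_fiveCongruent_hessePencilInd)
    (W A : WeierstrassCurve ℚ) [W.IsElliptic] [A.IsElliptic] (l m : ℚ) (C : VariableChange ℚ)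
    (hC : C • A = hessePencil5ind W.c₄ W.c₆ l m) :
    ∃ e : geomTorsion A (5 : ℤ) ≃+ geomTorsion W (5 : ℤ),
      ∀ (σ : Field.absoluteGaloisGroup ℚ) (P : geomTorsion A (5 : ℤ)), e (σ • P) = σ • e P := by
  haveI : (hessePencil5ind W.c₄ W.c₆ l m).IsElliptic := by rw [← hC]; infer_instance
  obtain ⟨e₁, he₁⟩ := fiveCongruent_hessePencil5ind hF' W l m
  obtain ⟨e₂, he₂⟩ : ∃ e : geomTorsion A (5 : ℤ) ≃+ geomTorsion (hessePencil5ind W.c₄ W.c₆ l m) (5 : ℤ),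
      ∀ (σ : Field.absoluteGaloisGroup ℚ) (P : geomTorsion A (5 : ℤ)), e (σ • P) = σ • e P := by
    rw [← hC]
    exact A.exists_geomTorsion_addEquiv_smul C 5
  exact ⟨e₂.trans e₁, fun σ P ↦ by rw [AddEquiv.trans_apply, AddEquiv.trans_apply, he₂, he₁]⟩

/-! ### §2. The integer-model consumers -/

/-- **`BSD(E,5)` for a target of analytic rank `≤ 1` from a partner of analytic rank `≤ 1` that is a member of the
Hesse pencil `X_E(5)`, both given by globally minimal INTEGER models; every Galois / reduction hypothesis from
DECIDABLE integer data.** Target `W` with integral model `[a₁,…,a₆]`: `5 ∤ Δ` (good), kernel point count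
`#Ẽ(𝔽₅) = n₅` with `5 ∤ 6 − n₅` (ordinary), a good prime `ℓ ≠ 5` with `#Ẽ(𝔽_ℓ) = n` and `X² − (ℓ + 1 − n)X + ℓ`
root-free mod `5` (`E[5]` irreducible, Mazur 1978 Prop. 6.3 (1)); partner `A` with integral model `[a′₁,…,a′₆]`:
`5 ∤ Δ′`, `#Ã(𝔽₅) = n′₅` with `5 ∤ 6 − n′₅`. C1: `hF` (Fisher 2012 Thm. 13.2, named fact) + `hC : C • A = E_{l,m}`.
Remaining binders: PUBLISHED `hBCS … hGZK`; FINITE `r_an(E) ≤ 1`, `r_an(A) ≤ 1`, `BSDp A 5`, C2 `hcertA`, C3 for the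
partner `hSchA` (vacuous unless `r_an(A) = 1`), C3 for the target `hC3` (vacuous unless `r_an(E) = 1`). The route is
gen 15's `bsdp_of_bsdpPartner_of_partnerRank_le_one_of_irr`: BCS 2025 Thm. 1.1.2 (a) + `BSD(A,5)` + C2 (+ C3) ⟹
Mazur's main conjecture for `(A,5)` with `μ = 0` ⟹ (Greenberg–Vatsal (1.4)) for `(E,5)` ⟹ `BSD(E,5)`.
[cite: Fisher2012Hessian, Thm. 13.2] [cite: GreenbergVatsal2000, Thm. (1.4) (arXiv p. 5)]
[cite: BurungaleCastellaSkinner2025, Thm. 1.1.2 (a) (p. 2 of arXiv:2405.00270v2)] [cite: Mazur1978, §6 Prop. 6.3 (1) (p. 153)]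
[cite: GreenbergLNM1716, Thm. 4.1 (p. 102)] [cite: PerrinRiou1987, §1.4 Cor. 1.8] -/
theorem bsdp_of_ainvs_of_bsdpPartner_of_hessePencil5_of_analyticRank_le_one
    (hF : thm132_fiveCongruent_hessePencil)
    (hBCS : burungale_castella_skinner_charIdeal_eq_padicLFunction)
    (hGr : greenberg_charValue_rankZero) (h5 : realPeriodRat_eq_unit_mul_plusPeriod)
    (hGV : GreenbergVatsal2000.thm14_mainConjecture_transfer_of_torsionIso)
    (hS : Schneider1985_order_charGenerator) (hPR : perrinRiou_rankOne_leadingTerms)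
    (hmodP : nonempty_modularParametrizationData) (hmodL : hasEntireLFunction_rat)
    (hGZK : rank_eq_analyticRank_of_analyticRank_le_one)
    (a1 a2 a3 a4 a6 : ℤ) {W : WeierstrassCurve ℚ} [W.IsElliptic] [W.IsGloballyMinimal]
    (hW : integralModelInt W = ⟨a1, a2, a3, a4, a6⟩)
    (b1 b2 b3 b4 b6 : ℤ) {A : WeierstrassCurve ℚ} [A.IsElliptic] [A.IsGloballyMinimal]
    (hA : integralModelInt A = ⟨b1, b2, b3, b4, b6⟩)
    (ℓ n np npA : ℕ) [Fact ℓ.Prime] [Fact (Nat.Prime 5)]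
    (hpΔ : ¬ (5 : ℤ) ∣ discOf [a1, a2, a3, a4, a6])
    (hcardp : Nat.card (((⟨a1, a2, a3, a4, a6⟩ : WeierstrassCurve ℤ).map
      (Int.castRingHom (ZMod 5))).toAffine.Point) = np)
    (hordp : ¬ (5 : ℤ) ∣ (5 : ℤ) + 1 - np)
    (hℓp : ℓ ≠ 5) (hℓΔ : ¬ (ℓ : ℤ) ∣ discOf [a1, a2, a3, a4, a6])
    (hcard : Nat.card (((⟨a1, a2, a3, a4, a6⟩ : WeierstrassCurve ℤ).map
      (Int.castRingHom (ZMod ℓ))).toAffine.Point) = n)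
    (hnoroot : ∀ t : ℕ, t < 5 → ¬ (5 : ℤ) ∣ (t : ℤ) ^ 2 - ((ℓ : ℤ) + 1 - n) * t + ℓ)
    (hpΔA : ¬ (5 : ℤ) ∣ discOf [b1, b2, b3, b4, b6])
    (hcardpA : Nat.card (((⟨b1, b2, b3, b4, b6⟩ : WeierstrassCurve ℤ).map
      (Int.castRingHom (ZMod 5))).toAffine.Point) = npA)
    (hordpA : ¬ (5 : ℤ) ∣ (5 : ℤ) + 1 - npA)
    (hran : W.analyticRank ≤ 1) (hrA : A.analyticRank ≤ 1) (hbsdA : BSDp A 5)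
    (hSchA : A.analyticRank = 1 → ∀ Dh : PAdicHeightData A 5, Dh.IsCanonical → SchneiderConjecture Dh)
    (hcertA : ∀ [NeZero (A.conductorNorm ℤ)] (fA : CuspForm (Gamma0 (A.conductorNorm ℤ)) 2),
        IsNewformOf A fA → ∀ (ϖ : ℚ), (ϖ : ℝ) * A.realPeriodRat = plusPeriod fA →
      ∃ n : ℕ, ‖PowerSeries.coeff n
        (PowerSeries.C (ϖ : ℚ_[5]) * padicLFunction fA (unitRoot A 5 : ℚ_[5]))‖ = 1)
    (l m : ℚ) (C : VariableChange ℚ) (hC : C • A = hessePencil5 W.c₄ W.c₆ l m)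
    (hC3 : W.analyticRank = 1 → ∀ Dh : PAdicHeightData W 5, Dh.IsCanonical → SchneiderConjecture Dh) :
    BSDp W 5 := by
  have hΔ : (⟨a1, a2, a3, a4, a6⟩ : WeierstrassCurve ℤ).Δ = discOf [a1, a2, a3, a4, a6] :=
    intCurve_Δ a1 a2 a3 a4 a6
  have hΔA : (⟨b1, b2, b3, b4, b6⟩ : WeierstrassCurve ℤ).Δ = discOf [b1, b2, b3, b4, b6] :=
    intCurve_Δ b1 b2 b3 b4 b6
  have hgood : W.HasGoodReductionAtPrime 5 :=
    hasGoodReductionAtPrime_of_not_dvd W 5 (by rw [minimalDiscriminantInt_eq hW, hΔ]; exact hpΔ)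
  have hord : ¬ ((5 : ℕ) : ℤ) ∣ W.frobeniusTrace 5 := by
    rw [frobeniusTrace_eq hW hcardp]; exact_mod_cast hordp
  have hgoodA : A.HasGoodReductionAtPrime 5 :=
    hasGoodReductionAtPrime_of_not_dvd A 5 (by rw [minimalDiscriminantInt_eq hA, hΔA]; exact hpΔA)
  have hordA : ¬ ((5 : ℕ) : ℤ) ∣ A.frobeniusTrace 5 := by
    rw [frobeniusTrace_eq hA hcardpA]; exact_mod_cast hordpA
  have hirr : W.HasIrreducibleModPGaloisRep 5 := by
    refine hasIrreducibleModPGaloisRep_of_intModel_of_noroot hW 5 ℓ hℓp (by rw [hΔ]; exact hℓΔ) hcard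
      (forall_zmod_of_forall_lt fun t ht h0 ↦ ?_)
    refine hnoroot t ht ?_
    have h5 : ((5 : ℕ) : ℤ) ∣ (t : ℤ) ^ 2 - ((ℓ : ℤ) + 1 - n) * t + ℓ := by
      rw [← ZMod.intCast_zmod_eq_zero_iff_dvd]
      push_cast at h0 ⊢
      linear_combination h0
    exact_mod_cast h5
  exact bsdp_of_bsdpPartner_of_partnerRank_le_one_of_irr W A 5 hBCS hGr h5 hGV hS hPR hmodP hmodL hGZK
    hran hgood hord (le_refl 5) hirr hgoodA hordA hrA hbsdA hSchA hcertA
    (torsionIso_of_hessePencil5 hF W A l m C hC) hC3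

/-- **The same for a partner in the indirect family `X_E⁻(5)`** (Fisher 2013 Thm. 5.8, named fact `hF'`).
[cite: Fisher2013QuinticTwists, Thm. 5.8] [cite: GreenbergVatsal2000, Thm. (1.4) (arXiv p. 5)]
[cite: BurungaleCastellaSkinner2025, Thm. 1.1.2 (a) (p. 2 of arXiv:2405.00270v2)] [cite: Mazur1978, §6 Prop. 6.3 (1) (p. 153)] -/
theorem bsdp_of_ainvs_of_bsdpPartner_of_hessePencil5ind_of_analyticRank_le_one
    (hF' : thm58_fiveCongruent_hessePencilInd)
    (hBCS : burungale_castella_skinner_charIdeal_eq_padicLFunction)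
    (hGr : greenberg_charValue_rankZero) (h5 : realPeriodRat_eq_unit_mul_plusPeriod)
    (hGV : GreenbergVatsal2000.thm14_mainConjecture_transfer_of_torsionIso)
    (hS : Schneider1985_order_charGenerator) (hPR : perrinRiou_rankOne_leadingTerms)
    (hmodP : nonempty_modularParametrizationData) (hmodL : hasEntireLFunction_rat)
    (hGZK : rank_eq_analyticRank_of_analyticRank_le_one)
    (a1 a2 a3 a4 a6 : ℤ) {W : WeierstrassCurve ℚ} [W.IsElliptic] [W.IsGloballyMinimal]
    (hW : integralModelInt W = ⟨a1, a2, a3, a4, a6⟩)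
    (b1 b2 b3 b4 b6 : ℤ) {A : WeierstrassCurve ℚ} [A.IsElliptic] [A.IsGloballyMinimal]
    (hA : integralModelInt A = ⟨b1, b2, b3, b4, b6⟩)
    (ℓ n np npA : ℕ) [Fact ℓ.Prime] [Fact (Nat.Prime 5)]
    (hpΔ : ¬ (5 : ℤ) ∣ discOf [a1, a2, a3, a4, a6])
    (hcardp : Nat.card (((⟨a1, a2, a3, a4, a6⟩ : WeierstrassCurve ℤ).map
      (Int.castRingHom (ZMod 5))).toAffine.Point) = np)
    (hordp : ¬ (5 : ℤ) ∣ (5 : ℤ) + 1 - np)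
    (hℓp : ℓ ≠ 5) (hℓΔ : ¬ (ℓ : ℤ) ∣ discOf [a1, a2, a3, a4, a6])
    (hcard : Nat.card (((⟨a1, a2, a3, a4, a6⟩ : WeierstrassCurve ℤ).map
      (Int.castRingHom (ZMod ℓ))).toAffine.Point) = n)
    (hnoroot : ∀ t : ℕ, t < 5 → ¬ (5 : ℤ) ∣ (t : ℤ) ^ 2 - ((ℓ : ℤ) + 1 - n) * t + ℓ)
    (hpΔA : ¬ (5 : ℤ) ∣ discOf [b1, b2, b3, b4, b6])
    (hcardpA : Nat.card (((⟨b1, b2, b3, b4, b6⟩ : WeierstrassCurve ℤ).map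
      (Int.castRingHom (ZMod 5))).toAffine.Point) = npA)
    (hordpA : ¬ (5 : ℤ) ∣ (5 : ℤ) + 1 - npA)
    (hran : W.analyticRank ≤ 1) (hrA : A.analyticRank ≤ 1) (hbsdA : BSDp A 5)
    (hSchA : A.analyticRank = 1 → ∀ Dh : PAdicHeightData A 5, Dh.IsCanonical → SchneiderConjecture Dh)
    (hcertA : ∀ [NeZero (A.conductorNorm ℤ)] (fA : CuspForm (Gamma0 (A.conductorNorm ℤ)) 2),
        IsNewformOf A fA → ∀ (ϖ : ℚ), (ϖ : ℝ) * A.realPeriodRat = plusPeriod fA →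
      ∃ n : ℕ, ‖PowerSeries.coeff n
        (PowerSeries.C (ϖ : ℚ_[5]) * padicLFunction fA (unitRoot A 5 : ℚ_[5]))‖ = 1)
    (l m : ℚ) (C : VariableChange ℚ) (hC : C • A = hessePencil5ind W.c₄ W.c₆ l m)
    (hC3 : W.analyticRank = 1 → ∀ Dh : PAdicHeightData W 5, Dh.IsCanonical → SchneiderConjecture Dh) :
    BSDp W 5 := by
  have hΔ : (⟨a1, a2, a3, a4, a6⟩ : WeierstrassCurve ℤ).Δ = discOf [a1, a2, a3, a4, a6] :=
    intCurve_Δ a1 a2 a3 a4 a6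
  have hΔA : (⟨b1, b2, b3, b4, b6⟩ : WeierstrassCurve ℤ).Δ = discOf [b1, b2, b3, b4, b6] :=
    intCurve_Δ b1 b2 b3 b4 b6
  have hgood : W.HasGoodReductionAtPrime 5 :=
    hasGoodReductionAtPrime_of_not_dvd W 5 (by rw [minimalDiscriminantInt_eq hW, hΔ]; exact hpΔ)
  have hord : ¬ ((5 : ℕ) : ℤ) ∣ W.frobeniusTrace 5 := by
    rw [frobeniusTrace_eq hW hcardp]; exact_mod_cast hordp
  have hgoodA : A.HasGoodReductionAtPrime 5 :=
    hasGoodReductionAtPrime_of_not_dvd A 5 (by rw [minimalDiscriminantInt_eq hA, hΔA]; exact hpΔA)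
  have hordA : ¬ ((5 : ℕ) : ℤ) ∣ A.frobeniusTrace 5 := by
    rw [frobeniusTrace_eq hA hcardpA]; exact_mod_cast hordpA
  have hirr : W.HasIrreducibleModPGaloisRep 5 := by
    refine hasIrreducibleModPGaloisRep_of_intModel_of_noroot hW 5 ℓ hℓp (by rw [hΔ]; exact hℓΔ) hcard
      (forall_zmod_of_forall_lt fun t ht h0 ↦ ?_)
    refine hnoroot t ht ?_
    have h5 : ((5 : ℕ) : ℤ) ∣ (t : ℤ) ^ 2 - ((ℓ : ℤ) + 1 - n) * t + ℓ := by
      rw [← ZMod.intCast_zmod_eq_zero_iff_dvd]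
      push_cast at h0 ⊢
      linear_combination h0
    exact_mod_cast h5
  exact bsdp_of_bsdpPartner_of_partnerRank_le_one_of_irr W A 5 hBCS hGr h5 hGV hS hPR hmodP hmodL hGZK
    hran hgood hord (le_refl 5) hirr hgoodA hordA hrA hbsdA hSchA hcertA
    (torsionIso_of_hessePencil5ind hF' W A l m C hC) hC3

/-! ### §3. C2 for a rank-`0` partner from its `L`-value (interpolation): no modular symbols needed -/

/-- **The unit-coefficient certificate C2 of a NON-ANOMALOUS rank-`0` partner is its `L`-value.** For `A/ℚ`
globally minimal, `p ≥ 5` good ordinary with `A[p]` irreducible, `p ∤ #Ã(𝔽_p)` (non-anomalous) and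
`L(A,1)/Ω_A = q` with `q ≠ 0`, `ord_p q = 0`: for the newform `f_A` and the period ratio `ϖ` (`ϖ·Ω_A = Ω⁺_{f_A}`)
the CONSTANT coefficient of `ϖ·L_p(f_A, α)` is a `p`-adic unit — Mazur–Tate–Teitelbaum's interpolation
`L_p(0) = (1 − α⁻¹)²·[0]⁺_f` (tree theorem `constantCoeff_padicLFunction_unitRoot`), `ϖ·[0]⁺_f = L(A,1)/Ω_A = q`,
`1 − α⁻¹ = u·#Ã(𝔽_p)` (tree theorem `exists_unit_one_sub_unitRoot_inv`) and `ord_p ϖ = 0` (period unit `h5`).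
So for such partners (conductor beyond every modular-symbol engine) C2 is the two-engine `L`-VALUE certificate
`L(A,1)/Ω_A = q`. [cite: MazurTateTeitelbaum1986Invent, §I.14 (14.3)] [cite: BalakrishnanMullerStein2015, Thm. 1.7 (remark following)]
[cite: GreenbergVatsal2000, §3, Remark 3.4] -/
theorem unitCoeff_zero_of_lvalue (h5 : realPeriodRat_eq_unit_mul_plusPeriod)
    (A : WeierstrassCurve ℚ) [A.IsElliptic] [A.IsGloballyMinimal] (p : ℕ) [Fact p.Prime] (hp : 5 ≤ p)
    (hgood : A.HasGoodReductionAtPrime p) (hord : ¬ (p : ℤ) ∣ A.frobeniusTrace p)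
    (hirr : A.HasIrreducibleModPGaloisRep p) (hna : ¬ p ∣ A.reductionPointCount p)
    {q : ℚ} (hq0 : q ≠ 0) (hL : A.entireLFunction 1 / (A.realPeriodRat : ℂ) = (q : ℂ))
    (hq : padicValRat p q = 0) :
    ∀ [NeZero (A.conductorNorm ℤ)] (fA : CuspForm (Gamma0 (A.conductorNorm ℤ)) 2),
        IsNewformOf A fA → ∀ (ϖ : ℚ), (ϖ : ℝ) * A.realPeriodRat = plusPeriod fA →
      ∃ n : ℕ, ‖PowerSeries.coeff n
        (PowerSeries.C (ϖ : ℚ_[p]) * padicLFunction fA (unitRoot A p : ℚ_[p]))‖ = 1 := by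
  intro _ fA hf ϖ hϖ
  refine ⟨0, ?_⟩
  have hordp : IsOrdinaryAt A p := ⟨hgood, hord⟩
  have hpP : p.Prime := Fact.out
  -- the period ratio is a `p`-adic unit
  have hϖn : ‖(ϖ : ℚ_[p])‖ = 1 := norm_periodRatio_eq_one h5 A p hp hgood hirr fA hf ϖ hϖ
  -- `ϖ · [0]⁺_f = q`
  set s : ℚ := ratPlusSymbol fA 0 with hs_def
  have hΩ : A.realPeriodRat ≠ 0 := A.realPeriodRat_pos_holds.ne'
  have hϖs : ϖ * s = q := by
    have h1 : ((ϖ * s : ℚ) : ℂ) = (q : ℂ) := by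
      rw [← hL, hf.entireLFunction_one_eq, ← hϖ, eq_div_iff (Complex.ofReal_ne_zero.mpr hΩ)]
      push_cast
      ring
    exact_mod_cast h1
  have hqn : ‖(q : ℚ_[p])‖ = 1 := by
    rw [Padic.eq_padicNorm, padicNorm.eq_zpow_of_nonzero hq0, hq, neg_zero, zpow_zero, Rat.cast_one]
  have hsn : ‖(s : ℚ_[p])‖ = 1 := by
    have : ‖((ϖ * s : ℚ) : ℚ_[p])‖ = 1 := by rw [hϖs]; exact hqn
    rw [Rat.cast_mul, norm_mul, hϖn, one_mul] at this
    exact this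
  -- `1 - α⁻¹` is a unit (non-anomalous)
  obtain ⟨u, hu⟩ := exists_unit_one_sub_unitRoot_inv p A hordp
  have hcnt : ‖(A.reductionPointCount p : ℚ_[p])‖ = 1 :=
    Padic.norm_natCast_eq_one_iff.mpr ((Nat.Prime.coprime_iff_not_dvd hpP).mpr hna)
  have hun : ‖((u : ℤ_[p]) : ℚ_[p])‖ = 1 := by
    rw [PadicInt.padic_norm_e_of_padicInt]
    exact PadicInt.isUnit_iff.mp u.isUnit
  have h1 : ‖(1 - ((unitRoot A p : ℤ_[p]) : ℚ_[p])⁻¹)‖ = 1 := by rw [hu, norm_mul, hun, hcnt, one_mul]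
  rw [PowerSeries.coeff_zero_eq_constantCoeff, map_mul, PowerSeries.constantCoeff_C,
    constantCoeff_padicLFunction_unitRoot hordp hf, norm_mul, norm_mul, norm_pow, hϖn, h1, one_pow, one_mul,
    one_mul, ← hs_def, hsn]

end Summit.BirchSwinnertonDyer.Rank1Residual.X9

end
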